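import Literature.MathematicalPhysics.QuantumFieldTheory.Balaban1983to89.Beta.PlaquetteVertex2Trace

/-!
# The polarised `(2,2)` plaquette kernel UN-PRE-SUMMED: nine colour words, their `N`-free position tables, and one traced weight per word

HONEST FRAMING (cell `pub-balaban`, β sub-cell, lineage an3; verbatim): discharging `BetaPertH` makes Bałaban's UV stability
UNCONDITIONAL — a real constructive-QFT result; it is NOT the continuum limit and NOT the Clay problem.  This file discharges NOTHING
of `BetaPertH`: it re-groups the kernel-checked eight-index table `K22` of `Beta.PlaquetteVertex2Polar` as a finite sum
`Σ_w (position table)_w ⊗ (colour word)_w` — colourless rational tables INDEXED BY their colour word — and records, per word, the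
fluctuation-colour trace in Bałaban's letters from `Beta.PlaquetteVertex2Trace`.  ABSOLUTE RULE of the cell: no internally minted
statement enters as a cited fact; every declaration below is a definition or is kernel-proved here from the imports; NOTHING is cited.

## What is proved

§1 THE NINE COLOUR WORDS of the polarised kernel (`τ` any real-linear functional, `t` any letters, `Y, Y′` the two background letters,
`a, b` the two fluctuation colours; each word carries its `½`):
`cwSeagull := ½τ([Y,t_a][Y′,t_b])`, `cwTrans := ½(τ(t_a Y [Y′,t_b]) − τ(t_a [Y,t_b] Y′))`, `cwAcc := ½(τ(t_a (YY′) t_b) − τ(t_a t_b (YY′)))`,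
`cwScalar := ½τ(t_a t_b (YY′))`, `cwSpinR := ½τ(t_a [Y,t_b] Y′)`, `cwSpinL := ½τ([Y,t_a] t_b Y′)` (the six words of `pSym`), and the three
PAIR words `pwScalar := ½(τ(t_a t_b (YY′)) − τ(t_b t_a (YY′)))`, `pwSpinL := ½(τ([Y,t_a] t_b Y′) − τ(t_b [Y,t_a] Y′))`, `pwSpinR := ½(τ(t_a [Y,t_b] Y′) −
τ([Y,t_b] t_a Y′))` (of `pPair`); and their `N`-FREE RATIONAL POSITION TABLES over `Fin 4` (`inc`, `cc`, `qq`, `sgn` of the imports):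
`tSeagull := inc_ik inc_jl`, `tTrans := inc_jk inc_jl`, `tAcc := cc_jkl`, `tScalar := qq_kl`, `tSpinR := inc_jk s_l`, `tSpinL := inc_ik s_l`
(the pair words ride on `tScalar`, `tSpinL`, `tSpinR`).

§2 THE DECOMPOSITION: **`pSym_eq_words`**, **`pPair_eq_words`** and
**`K22_eq_words : K22 τ t i j k l a b c d = s_i s_j (Σ_{six words} t_w(i,j,k,l) · cw_w(t_a,t_b; t_c,t_d) + [i<j]·Σ_{pair words} t_w · pw_w)`** —
the kernel is a finite sum of COLOURLESS position tables tensored with colour words (the packaging «tables indexed by their colour matrix»).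

§3 ONE TRACED WEIGHT PER WORD in Bałaban's letters (`𝔸 = Mat_N(ℂ)` with Mathlib's `L¹–L^∞` operator norm as a LOCAL instance, statements
norm-free; `rntr = N⁻¹·Re Tr`, `gen τ c = I•τ c`; hypotheses `Complete τ`, `TrOrthonormal τ`, `N ≠ 0` — the per-word sums of
`PlaquetteVertex2Trace` §2 BY NAME): on the colour diagonal `a = b`, summed over `a`, at background letters `t_c, t_d`, each word gives
`[c = d]·κ_w(N)` with **`κ = (−N², N², 0, ½(N²−1), −½N², ½N²)`** for (seagull, trans, acc, scalar, spinR, spinL) and **`(0, N², −N²)`** for the pair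
words (scalar, spinL, spinR); `cwAcc` and `pwScalar` vanish on the colour diagonal termwise for ANY letters (cyclicity).

§4 CONSISTENCY WITH THE PRE-SUMMED TABLE: **`wSym_eq_weights`**, **`wPair_eq_weights`**, **`w22_eq_weights`** — `w22 N i j k l = s_i s_j (Σ_w κ_w(N)·t_w +
[i<j]·Σ κ·t)` (`ring`), and `sum_K22_diag` re-derived word by word from the nine weights alone (an `example`).

Gloss.  Identity-level bookkeeping (`ring`-certified re-grouping; no new numerics).  Answers the packaging request F-an2g8-1 (F2) of the
cell's journal on an3's side.  NOT PROVED HERE, NOT CLAIMED: the identification of the colour words with `ad`-matrices in any particular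
normalisation (lit1's lane), any propagator or contraction over positions / plaquettes / scales, any value of a β-function coefficient or
bound, gauge fixing/averaging, anything of `BetaPertH`, UV stability, the continuum limit or the Clay problem.  GAPS record C-beta-an3-34
(HOME/GAPS.md of the cell).  All tags [folklore].
-/

noncomputable section

namespace Literature.MathematicalPhysics.QuantumFieldTheory.Balaban1983to89.Beta.PlaquetteVertex2Words

open Finset
open scoped BigOperators
open Literature.MathematicalPhysics.QuantumFieldTheory.Balaban1983to89.Beta.ColourTrace (Complete TrOrthonormal)
open Literature.MathematicalPhysics.QuantumFieldTheory.Balaban1983to89.Beta.PlaquetteVertex (rntr rntr_comm gen)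
open Literature.MathematicalPhysics.QuantumFieldTheory.Balaban1983to89.Beta.SpinTable (br)
open Literature.MathematicalPhysics.QuantumFieldTheory.Balaban1983to89.Beta.PlaquetteVertex2Coords (sgn)
open Literature.MathematicalPhysics.QuantumFieldTheory.Balaban1983to89.Beta.PlaquetteVertex2Polar (inc cc qq pSym pPair K22 K22_eq)
open Literature.MathematicalPhysics.QuantumFieldTheory.Balaban1983to89.Beta.PlaquetteVertex2Trace

/-! ## §1 The nine colour words and their position tables -/

section Words

variable {𝔸 : Type*} [NormedRing 𝔸] [NormedAlgebra ℝ 𝔸] {C : Type*}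

/-- SEAGULL word `½τ([Y,t_a][Y′,t_b])`. [folklore] -/
def cwSeagull (τ : 𝔸 →ₗ[ℝ] ℝ) (t : C → 𝔸) (Y Y' : 𝔸) (a b : C) : ℝ := 2⁻¹ * τ (br Y (t a) * br Y' (t b))

/-- TRANSPORT word (difference) `½(τ(t_a Y [Y′,t_b]) − τ(t_a [Y,t_b] Y′))`. [folklore] -/
def cwTrans (τ : 𝔸 →ₗ[ℝ] ℝ) (t : C → 𝔸) (Y Y' : 𝔸) (a b : C) : ℝ :=
  2⁻¹ * (τ (t a * Y * br Y' (t b)) - τ (t a * br Y (t b) * Y'))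

/-- ACCUMULATED-COMMUTATOR word (difference) `½(τ(t_a (YY′) t_b) − τ(t_a t_b (YY′)))`. [folklore] -/
def cwAcc (τ : 𝔸 →ₗ[ℝ] ℝ) (t : C → 𝔸) (Y Y' : 𝔸) (a b : C) : ℝ :=
  2⁻¹ * (τ (t a * (Y * Y') * t b) - τ (t a * t b * (Y * Y')))

/-- SCALAR-SLOT word `½τ(t_a t_b (YY′))`. [folklore] -/
def cwScalar (τ : 𝔸 →ₗ[ℝ] ℝ) (t : C → 𝔸) (Y Y' : 𝔸) (a b : C) : ℝ := 2⁻¹ * τ (t a * t b * (Y * Y'))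

/-- RIGHT SPIN word `½τ(t_a [Y,t_b] Y′)`. [folklore] -/
def cwSpinR (τ : 𝔸 →ₗ[ℝ] ℝ) (t : C → 𝔸) (Y Y' : 𝔸) (a b : C) : ℝ := 2⁻¹ * τ (t a * br Y (t b) * Y')

/-- LEFT SPIN word `½τ([Y,t_a] t_b Y′)`. [folklore] -/
def cwSpinL (τ : 𝔸 →ₗ[ℝ] ℝ) (t : C → 𝔸) (Y Y' : 𝔸) (a b : C) : ℝ := 2⁻¹ * τ (br Y (t a) * t b * Y')

/-- PAIR scalar word `½(τ(t_a t_b (YY′)) − τ(t_b t_a (YY′)))`. [folklore] -/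
def pwScalar (τ : 𝔸 →ₗ[ℝ] ℝ) (t : C → 𝔸) (Y Y' : 𝔸) (a b : C) : ℝ :=
  2⁻¹ * (τ (t a * t b * (Y * Y')) - τ (t b * t a * (Y * Y')))

/-- PAIR left-spin word `½(τ([Y,t_a] t_b Y′) − τ(t_b [Y,t_a] Y′))`. [folklore] -/
def pwSpinL (τ : 𝔸 →ₗ[ℝ] ℝ) (t : C → 𝔸) (Y Y' : 𝔸) (a b : C) : ℝ :=
  2⁻¹ * (τ (br Y (t a) * t b * Y') - τ (t b * br Y (t a) * Y'))

/-- PAIR right-spin word `½(τ(t_a [Y,t_b] Y′) − τ([Y,t_b] t_a Y′))`. [folklore] -/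
def pwSpinR (τ : 𝔸 →ₗ[ℝ] ℝ) (t : C → 𝔸) (Y Y' : 𝔸) (a b : C) : ℝ :=
  2⁻¹ * (τ (t a * br Y (t b) * Y') - τ (br Y (t b) * t a * Y'))

end Words

section Tables

/-- position table of the seagull word: `inc_ik · inc_jl`. [folklore] -/
def tSeagull (i j k l : Fin 4) : ℝ := inc i k * inc j l

/-- position table of the transport word: `inc_jk · inc_jl`. [folklore] -/
def tTrans (_i j k l : Fin 4) : ℝ := inc j k * inc j l

/-- position table of the accumulated-commutator word: `cc_jkl`. [folklore] -/
def tAcc (_i j k l : Fin 4) : ℝ := cc j k l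

/-- position table of the scalar-slot words: `qq_kl`. [folklore] -/
def tScalar (_i _j k l : Fin 4) : ℝ := qq k l

/-- position table of the right-spin words: `inc_jk · s_l`. [folklore] -/
def tSpinR (_i j k l : Fin 4) : ℝ := inc j k * sgn l

/-- position table of the left-spin words: `inc_ik · s_l`. [folklore] -/
def tSpinL (i _j k l : Fin 4) : ℝ := inc i k * sgn l

end Tables

/-! ## §2 The kernel as a sum of (position table) ⊗ (colour word) -/

section Decomposition

variable {𝔸 : Type*} [NormedRing 𝔸] [NormedAlgebra ℝ 𝔸] {C : Type*}

/-- **`pSym` UN-PRE-SUMMED**: the six words with their tables. [folklore] -/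
theorem pSym_eq_words (τ : 𝔸 →ₗ[ℝ] ℝ) (t : C → 𝔸) (i j k l : Fin 4) (Y Y' : 𝔸) (a b : C) :
    pSym τ t i j k l Y Y' a b
      = tSeagull i j k l * cwSeagull τ t Y Y' a b + tTrans i j k l * cwTrans τ t Y Y' a b + tAcc i j k l * cwAcc τ t Y Y' a b
        + tScalar i j k l * cwScalar τ t Y Y' a b + tSpinR i j k l * cwSpinR τ t Y Y' a b + tSpinL i j k l * cwSpinL τ t Y Y' a b := by
  simp only [pSym, tSeagull, cwSeagull, tTrans, cwTrans, tAcc, cwAcc, tScalar, cwScalar, tSpinR, cwSpinR, tSpinL, cwSpinL]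
  ring

/-- **`pPair` UN-PRE-SUMMED**: the three pair words with their tables. [folklore] -/
theorem pPair_eq_words (τ : 𝔸 →ₗ[ℝ] ℝ) (t : C → 𝔸) (i j k l : Fin 4) (Y Y' : 𝔸) (a b : C) :
    pPair τ t i j k l Y Y' a b
      = tScalar i j k l * pwScalar τ t Y Y' a b + tSpinL i j k l * pwSpinL τ t Y Y' a b + tSpinR i j k l * pwSpinR τ t Y Y' a b := by
  simp only [pPair, tScalar, pwScalar, tSpinL, pwSpinL, tSpinR, pwSpinR]
  ring

/-- **THE POLARISED `(2,2)` KERNEL AS `Σ_w (position table)_w ⊗ (colour word)_w`**: colourless rational tables indexed by their colour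
word, background letters `t_c, t_d`. [folklore] -/
theorem K22_eq_words (τ : 𝔸 →ₗ[ℝ] ℝ) (t : C → 𝔸) (i j k l : Fin 4) (a b c d : C) :
    K22 τ t i j k l a b c d
      = sgn i * sgn j *
        (tSeagull i j k l * cwSeagull τ t (t c) (t d) a b + tTrans i j k l * cwTrans τ t (t c) (t d) a b
            + tAcc i j k l * cwAcc τ t (t c) (t d) a b + tScalar i j k l * cwScalar τ t (t c) (t d) a b
            + tSpinR i j k l * cwSpinR τ t (t c) (t d) a b + tSpinL i j k l * cwSpinL τ t (t c) (t d) a b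
          + if i < j then
              tScalar i j k l * pwScalar τ t (t c) (t d) a b + tSpinL i j k l * pwSpinL τ t (t c) (t d) a b
                + tSpinR i j k l * pwSpinR τ t (t c) (t d) a b
            else 0) := by
  rw [K22_eq, pSym_eq_words, pPair_eq_words]

end Decomposition

/-! ## §3 One traced weight per word, in Bałaban's letters -/

section Weights

-- Mathlib's `L¹–L^∞` operator norm on square matrices is a `def`, not a global instance; enabled LOCALLY (as in `Beta.PlaquetteVertex`
-- §4 and `Beta.PlaquetteVertex2Trace`) only to type the norm-generic words over `Mat_N(ℂ)`; every statement below is norm-free.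
attribute [local instance] Matrix.linftyOpNormedRing Matrix.linftyOpNormedAlgebra

variable {N : ℕ} {C : Type*} [Fintype C] [DecidableEq C]

/-- seagull: `Σ_a cwSeagull(a,a) = [c=d]·(−N²)`. [folklore] -/
theorem sum_cwSeagull_diag {τ : C → Matrix (Fin N) (Fin N) ℂ} (hτ : Complete τ) (ho : TrOrthonormal τ) (hN : N ≠ 0) (c d : C) :
    ∑ a, cwSeagull rntr (gen τ) (gen τ c) (gen τ d) a a = if c = d then -((N : ℝ) ^ 2) else 0 := by
  simp only [cwSeagull, ← Finset.mul_sum, sum_rntr_seagull hτ ho hN]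
  split_ifs <;> ring

/-- transport: `Σ_a cwTrans(a,a) = [c=d]·N²`. [folklore] -/
theorem sum_cwTrans_diag {τ : C → Matrix (Fin N) (Fin N) ℂ} (hτ : Complete τ) (ho : TrOrthonormal τ) (hN : N ≠ 0) (c d : C) :
    ∑ a, cwTrans rntr (gen τ) (gen τ c) (gen τ d) a a = if c = d then (N : ℝ) ^ 2 else 0 := by
  simp only [cwTrans, ← Finset.mul_sum, Finset.sum_sub_distrib, sum_rntr_mul_mul_br hτ ho hN, sum_rntr_mul_br_mul hτ ho hN]
  split_ifs <;> ring

omit [DecidableEq C] in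
/-- accumulated commutator: vanishes on the colour diagonal termwise, for ANY letters (cyclicity). [folklore] -/
theorem sum_cwAcc_diag (t : C → Matrix (Fin N) (Fin N) ℂ) (Y Y' : Matrix (Fin N) (Fin N) ℂ) :
    ∑ a, cwAcc rntr t Y Y' a a = 0 := by
  simp only [cwAcc, rntr_sandwich, sub_self, mul_zero, Finset.sum_const_zero]

/-- scalar slot: `Σ_a cwScalar(a,a) = [c=d]·½(N²−1)`. [folklore] -/
theorem sum_cwScalar_diag {τ : C → Matrix (Fin N) (Fin N) ℂ} (hτ : Complete τ) (ho : TrOrthonormal τ) (hN : N ≠ 0) (c d : C) :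
    ∑ a, cwScalar rntr (gen τ) (gen τ c) (gen τ d) a a = if c = d then 2⁻¹ * ((N : ℝ) ^ 2 - 1) else 0 := by
  simp only [cwScalar, ← Finset.mul_sum, sum_rntr_sq_mul hτ ho hN]
  split_ifs <;> ring

/-- right spin: `Σ_a cwSpinR(a,a) = [c=d]·(−½N²)`. [folklore] -/
theorem sum_cwSpinR_diag {τ : C → Matrix (Fin N) (Fin N) ℂ} (hτ : Complete τ) (ho : TrOrthonormal τ) (hN : N ≠ 0) (c d : C) :
    ∑ a, cwSpinR rntr (gen τ) (gen τ c) (gen τ d) a a = if c = d then -(2⁻¹ * (N : ℝ) ^ 2) else 0 := by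
  simp only [cwSpinR, ← Finset.mul_sum, sum_rntr_mul_br_mul hτ ho hN]
  split_ifs <;> ring

/-- left spin: `Σ_a cwSpinL(a,a) = [c=d]·½N²`. [folklore] -/
theorem sum_cwSpinL_diag {τ : C → Matrix (Fin N) (Fin N) ℂ} (hτ : Complete τ) (ho : TrOrthonormal τ) (hN : N ≠ 0) (c d : C) :
    ∑ a, cwSpinL rntr (gen τ) (gen τ c) (gen τ d) a a = if c = d then 2⁻¹ * (N : ℝ) ^ 2 else 0 := by
  simp only [cwSpinL, ← Finset.mul_sum, sum_rntr_br_mul_mul hτ ho hN]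
  split_ifs <;> ring

omit [DecidableEq C] in
/-- pair scalar: vanishes on the colour diagonal termwise, for ANY letters. [folklore] -/
theorem sum_pwScalar_diag (t : C → Matrix (Fin N) (Fin N) ℂ) (Y Y' : Matrix (Fin N) (Fin N) ℂ) :
    ∑ a, pwScalar rntr t Y Y' a a = 0 := by
  simp only [pwScalar, sub_self, mul_zero, Finset.sum_const_zero]

/-- pair left spin: `Σ_a pwSpinL(a,a) = [c=d]·N²`. [folklore] -/
theorem sum_pwSpinL_diag {τ : C → Matrix (Fin N) (Fin N) ℂ} (hτ : Complete τ) (ho : TrOrthonormal τ) (hN : N ≠ 0) (c d : C) :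
    ∑ a, pwSpinL rntr (gen τ) (gen τ c) (gen τ d) a a = if c = d then (N : ℝ) ^ 2 else 0 := by
  simp only [pwSpinL, ← Finset.mul_sum, Finset.sum_sub_distrib, sum_rntr_br_mul_mul hτ ho hN, sum_rntr_mul_br_mul hτ ho hN]
  split_ifs <;> ring

/-- pair right spin: `Σ_a pwSpinR(a,a) = [c=d]·(−N²)`. [folklore] -/
theorem sum_pwSpinR_diag {τ : C → Matrix (Fin N) (Fin N) ℂ} (hτ : Complete τ) (ho : TrOrthonormal τ) (hN : N ≠ 0) (c d : C) :
    ∑ a, pwSpinR rntr (gen τ) (gen τ c) (gen τ d) a a = if c = d then -((N : ℝ) ^ 2) else 0 := by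
  simp only [pwSpinR, ← Finset.mul_sum, Finset.sum_sub_distrib, sum_rntr_mul_br_mul hτ ho hN, sum_rntr_br_mul_mul hτ ho hN]
  split_ifs <;> ring

/-- **`sum_K22_diag` WORD BY WORD** (an `example`, the statement being `PlaquetteVertex2Trace.sum_K22_diag` already landed): the
fluctuation-colour trace of the kernel, assembled from the nine per-word weights ALONE, is `[c=d]·w22` — consistency of §3 with the
pre-summed table, re-derived through the words. [folklore] -/
example {τ : C → Matrix (Fin N) (Fin N) ℂ} (hτ : Complete τ) (ho : TrOrthonormal τ) (hN : N ≠ 0)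
    (i j k l : Fin 4) (c d : C) :
    ∑ a, K22 rntr (gen τ) i j k l a a c d = if c = d then w22 N i j k l else 0 := by
  unfold w22 wSym wPair
  by_cases h : i < j
  · simp only [K22_eq_words, if_pos h, Finset.sum_add_distrib, ← Finset.mul_sum, sum_cwSeagull_diag hτ ho hN,
      sum_cwTrans_diag hτ ho hN, sum_cwAcc_diag, sum_cwScalar_diag hτ ho hN, sum_cwSpinR_diag hτ ho hN, sum_cwSpinL_diag hτ ho hN,
      sum_pwScalar_diag, sum_pwSpinL_diag hτ ho hN, sum_pwSpinR_diag hτ ho hN]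
    unfold tSeagull tTrans tAcc tScalar tSpinR tSpinL
    split_ifs <;> ring
  · simp only [K22_eq_words, if_neg h, add_zero, Finset.sum_add_distrib, ← Finset.mul_sum, sum_cwSeagull_diag hτ ho hN,
      sum_cwTrans_diag hτ ho hN, sum_cwAcc_diag, sum_cwScalar_diag hτ ho hN, sum_cwSpinR_diag hτ ho hN, sum_cwSpinL_diag hτ ho hN]
    unfold tSeagull tTrans tAcc tScalar tSpinR tSpinL
    split_ifs <;> ring

end Weights

/-! ## §4 Consistency with the pre-summed position table -/

section Consistency

/-- **`wSym` FROM THE WEIGHTS**: `wSym = (−N²)·tSeagull + N²·tTrans + 0·tAcc + ½(N²−1)·tScalar + (−½N²)·tSpinR + ½N²·tSpinL`. [folklore] -/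
theorem wSym_eq_weights (N : ℕ) (i j k l : Fin 4) :
    wSym N i j k l
      = -((N : ℝ) ^ 2) * tSeagull i j k l + (N : ℝ) ^ 2 * tTrans i j k l + 0 * tAcc i j k l
        + 2⁻¹ * ((N : ℝ) ^ 2 - 1) * tScalar i j k l + -(2⁻¹ * (N : ℝ) ^ 2) * tSpinR i j k l + 2⁻¹ * (N : ℝ) ^ 2 * tSpinL i j k l := by
  unfold wSym tSeagull tTrans tAcc tScalar tSpinR tSpinL
  ring

/-- **`wPair` FROM THE WEIGHTS**: `wPair = 0·tScalar + N²·tSpinL + (−N²)·tSpinR`. [folklore] -/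
theorem wPair_eq_weights (N : ℕ) (i j k l : Fin 4) :
    wPair N i j k l = 0 * tScalar i j k l + (N : ℝ) ^ 2 * tSpinL i j k l + -((N : ℝ) ^ 2) * tSpinR i j k l := by
  unfold wPair tScalar tSpinL tSpinR
  ring

/-- **`w22` FROM THE WEIGHTS**: one real weight per colour word against its position table. [folklore] -/
theorem w22_eq_weights (N : ℕ) (i j k l : Fin 4) :
    w22 N i j k l
      = sgn i * sgn j *
        (-((N : ℝ) ^ 2) * tSeagull i j k l + (N : ℝ) ^ 2 * tTrans i j k l + 0 * tAcc i j k l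
            + 2⁻¹ * ((N : ℝ) ^ 2 - 1) * tScalar i j k l + -(2⁻¹ * (N : ℝ) ^ 2) * tSpinR i j k l + 2⁻¹ * (N : ℝ) ^ 2 * tSpinL i j k l
          + if i < j then 0 * tScalar i j k l + (N : ℝ) ^ 2 * tSpinL i j k l + -((N : ℝ) ^ 2) * tSpinR i j k l else 0) := by
  rw [w22, wSym_eq_weights, wPair_eq_weights]

end Consistency

/-! ## §5 Examples -/

section Examples

/-- the seagull table couples fluctuation position `i` to the background letters BEFORE it (`k < i`, signed) and `j` to those before
it: `tSeagull 1 2 0 1 = 1`, `tSeagull 1 2 1 0 = 0`. [folklore] -/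
example : tSeagull 1 2 0 1 = 1 ∧ tSeagull 1 2 1 0 = 0 := by
  constructor <;> simp [tSeagull, inc]

/-- at `N = 1` (abelian letters) the scalar-slot weight `½(N²−1)` vanishes while the commutator-word weights do not — the word weights
are NOT all multiples of `N² − 1`. [folklore] -/
example : (2⁻¹ * (((1 : ℕ) : ℝ) ^ 2 - 1) = 0) ∧ (-(((1 : ℕ) : ℝ) ^ 2) = -1) := by
  norm_num

end Examples

end Literature.MathematicalPhysics.QuantumFieldTheory.Balaban1983to89.Beta.PlaquetteVertex2Words
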